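import Summits.ValiantsHypothesis.ValiantsHypothesis.Theorems.SymPencilPerFourOriginPackage
import Summits.ValiantsHypothesis.ValiantsHypothesis.Theorems.SymPencilPerFourLowRankSevenSharp
import Summits.ValiantsHypothesis.ValiantsHypothesis.Theorems.SymPencilPerFourBlocksEq

/-!
# Route `SymPencil` — size `25`: reduction to the Lagrangian one-row kernel
# (the rung `26` as a REDUCTION modulo two named cells; `--supports` stmt-ValiantsHypothesis-5674
# `SdcSuperquadratic`; rung currency only — see `Cruxes/SdcSuperquadratic/NEXT-RUNG-25.md`)

The origin package of val-width-5674-p2 (`SymPencilPerFourOriginPackage`) attaches to a symmetric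
affine determinantal representation `A` of `per_4` of size `m` (characteristic `0`) the data
`(D, bL, CL, κ)` of its kernel normal form with the three origin-moment identities, `V = ker bL ⊆
Sing Z(per_4)`, `r = dim im bL`, `dim V + r = 16`, `2r ≤ m - 1`, `dim V ≤ 8`, and — through
`SymPencilIsotropicKernelSquaresBilinear` — for every `d ≥ m - 1 - 2r` the JOINT ("inner rank")
reading `per_4 (u + s y) = e₀ + s e₁ + s² Σ_{j<d} c_j β_j(u, y)²` (`β_j` bilinear, `y ∈ V`).

**Theorem** (`eq_twentyFive_and_oneRowKernel_of_le_twentyFive`).  Assume the two CELL HYPOTHESES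
* `H88`: no `8`-dimensional `V ⊆ Sing Z(per_4)` carries a joint family with `8` squares
  (inner rank of `per_4` along an `8`-dimensional singular subspace is `≥ 9`; Task T2 — by
  BoxFour equality such `V` is a two-row block; val-width-5674-p1's numerics: 2-point systems
  solvable, 3-point unsolvable), and
* `H106`: no `6`-dimensional `V ⊆ Sing Z(per_4)` carries a joint family with `4` squares
  (conjecturally because `rank Hess ≤ 5` on `V` forces a `2 × 3` block, killed by the per-base-point
  reading — Task T6″ of the note).
Then a symmetric affine determinantal representation of `per_4` of size `m ≤ 25` has `m = 25`
EXACTLY, and its origin data have `2 · dim im bL = 24` (the kernel rows are LAGRANGIAN) and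
`dim ker bL = 4` with `ker bL` contained in a single row or a single column of `K^{4×4}`.

So, given `H88` and `H106`, the rung `sdc(per_4) ≥ 26` is EQUIVALENT to excluding the Lagrangian
one-row (one-column) kernel at size `25` — the cell `(12, 4, 0)`, invisible to every second-moment
reading (`per_4 (u + s y)` is affine in `s` along a row).  Unconditional inputs used: the cases
`r = 9` (`SymPencilPerFourLowRankSevenSharp.noLowRank_seven₆`, this seat), `r = 11`
(`SymPencilPerFourHessianBlocks.finrank_le_four_of_sum_sq_swap`, p2), `r = 12`
(`SymPencilPerFourBlocks.perm_two_blocks_of_affine`, p2, and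
`SymPencilPerFourBlocksEq.row_or_col_of_perm_two_blocks`, val-width-5676-p2 g3).

Honest framing: a conditional reduction with two OPEN, non-vacuous hypotheses (both are statements
about bilinear families, not about bare subspaces: the two-row block and the `2 × 3` block satisfy
the per-base-point and per-direction readings with `8` resp. `4` squares, so weaker hypotheses
would be unsatisfiable); no new lower bound (`sdc(per_4) ≥ 25` stands); the crux
`SdcSuperquadratic` and `VP ≠ VNP` are untouched.  No definitions, no named facts. [folklore]
-/

noncomputable section

-- single-conjunct layout: Sub = Summit, duplicated namespace component intended
set_option linter.dupNamespace false

namespace Summit.ValiantsHypothesis.ValiantsHypothesis.Theorems.SymPencilSdcPerFourTwentySixReduction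

open Matrix MvPolynomial Module
open Literature.Computability.AlgebraicComplexity
open Summit.ValiantsHypothesis.ValiantsHypothesis.Theorems.SymPencilPerFourOriginPackage
open Summit.ValiantsHypothesis.ValiantsHypothesis.Theorems.SymPencilIsotropicKernelSquaresBilinear
open Summit.ValiantsHypothesis.ValiantsHypothesis.Theorems.SymPencilPerFourBlocks
open Summit.ValiantsHypothesis.ValiantsHypothesis.Theorems.SymPencilPerFourHessianBlocks
open Summit.ValiantsHypothesis.ValiantsHypothesis.Theorems.SymPencilPerFourLowRankSevenSharp
open Summit.ValiantsHypothesis.ValiantsHypothesis.Theorems.SymPencilPerFourBlocksEq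
open Summit.ValiantsHypothesis.ValiantsHypothesis.Theorems.SymPencilBoxFourEquality

/-- **Size `≤ 25` forces size `25` with a Lagrangian one-row (one-column) kernel**, given the cell
hypotheses `H88` (inner rank `≥ 9` along `8`-dimensional singular subspaces) and `H106` (no joint
`4`-square family along `6`-dimensional singular subspaces).  See the module docstring.
[folklore] -/
theorem eq_twentyFive_and_oneRowKernel_of_le_twentyFive (K : Type*) [Field K] [CharZero K]
    (H88 : ∀ V : Submodule K (Fin 4 × Fin 4 → K),
      (∀ x ∈ V, ∀ (r c : Fin 3 → Fin 4), Function.Injective r → Function.Injective c →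
        ((Matrix.of fun i j => x (i, j)).submatrix r c).permanent = 0) →
      finrank K V = 8 → ∀ (c : Fin 8 → K)
        (β : Fin 8 → ((Fin 4 × Fin 4 → K) →ₗ[K] (Fin 4 × Fin 4 → K) →ₗ[K] K)),
      ¬ (∀ u : Fin 4 × Fin 4 → K, ∀ y ∈ V, ∃ e₀ e₁ : K, ∀ s : K,
          eval (u + s • y) (perPoly (Fin 4) K) = e₀ + s * e₁ + s ^ 2 * ∑ k, c k * (β k u y) ^ 2))
    (H106 : ∀ V : Submodule K (Fin 4 × Fin 4 → K),
      (∀ x ∈ V, ∀ (r c : Fin 3 → Fin 4), Function.Injective r → Function.Injective c →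
        ((Matrix.of fun i j => x (i, j)).submatrix r c).permanent = 0) →
      finrank K V = 6 → ∀ (c : Fin 4 → K)
        (β : Fin 4 → ((Fin 4 × Fin 4 → K) →ₗ[K] (Fin 4 × Fin 4 → K) →ₗ[K] K)),
      ¬ (∀ u : Fin 4 × Fin 4 → K, ∀ y ∈ V, ∃ e₀ e₁ : K, ∀ s : K,
          eval (u + s • y) (perPoly (Fin 4) K) = e₀ + s * e₁ + s ^ 2 * ∑ k, c k * (β k u y) ^ 2))
    {m : ℕ} (hm : m ≤ 25) {A : Matrix (Fin m) (Fin m) (MvPolynomial (Fin 4 × Fin 4) K)}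
    (hS : A.IsSymm) (hA : IsAffineDetRepr (perPoly (Fin 4) K) A) :
    m = 25 ∧
    ∃ (i₀ : Fin m) (D : Matrix {i // i ≠ i₀} {i // i ≠ i₀} K)
      (bL : (Fin 4 × Fin 4 → K) →ₗ[K] ({i // i ≠ i₀} → K))
      (CL : (Fin 4 × Fin 4 → K) →ₗ[K] Matrix {i // i ≠ i₀} {i // i ≠ i₀} K) (κ : K),
      IsUnit D.det ∧ Dᵀ = D ∧ (∀ z, (CL z)ᵀ = CL z) ∧ κ ≠ 0 ∧
      (∀ z, bL z ⬝ᵥ D⁻¹ *ᵥ bL z = 0) ∧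
      (∀ z, bL z ⬝ᵥ (D⁻¹ * CL z * D⁻¹) *ᵥ bL z = 0) ∧
      (∀ z, D.det * (bL z ⬝ᵥ (D⁻¹ * CL z * D⁻¹ * CL z * D⁻¹) *ᵥ bL z) =
        -(κ * eval z (perPoly (Fin 4) K))) ∧
      2 * finrank K (LinearMap.range bL) = 24 ∧ finrank K (LinearMap.ker bL) = 4 ∧
      ((∃ l : Fin 4, ∀ x ∈ LinearMap.ker bL, ∀ i j : Fin 4, i ≠ l → x (i, j) = 0) ∨
       (∃ c : Fin 4, ∀ x ∈ LinearMap.ker bL, ∀ i j : Fin 4, j ≠ c → x (i, j) = 0)) := by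
  classical
  obtain ⟨i₀, D, bL, CL, κ, hD, hDs, hCs, hκ, hi, hii, hiii, hV4, hcard, hranle, hrn, hkerle⟩ :=
    origin_package_of_isSymm_isAffineDetRepr_perPoly_four K hS hA
  set V := LinearMap.ker bL with hVdef
  have hV3 : ∀ x ∈ V, ∀ (r c : Fin 3 → Fin 4), Function.Injective r → Function.Injective c →
      ((Matrix.of fun i j => x (i, j)).submatrix r c).permanent = 0 :=
    fun x hx r c hr hc => subperm_vanish_inj_of_succAbove x (hV4 x hx) r c hr hc
  -- the joint reading with `d` squares, for every admissible `d`
  have family : ∀ d : ℕ, Fintype.card {i // i ≠ i₀} ≤ 2 * finrank K (LinearMap.range bL) + d →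
      ∃ (c : Fin d → K) (β : Fin d → ((Fin 4 × Fin 4 → K) →ₗ[K] (Fin 4 × Fin 4 → K) →ₗ[K] K)),
        ∀ u : Fin 4 × Fin 4 → K, ∀ y ∈ V, ∃ e₀ e₁ : K, ∀ s : K,
          eval (u + s • y) (perPoly (Fin 4) K) = e₀ + s * e₁ + s ^ 2 * ∑ k, c k * (β k u y) ^ 2 := by
    intro d hd
    obtain ⟨c, β, hcβ⟩ := sum_sq_of_isotropic_defect_bilinear hD hDs bL CL hCs
      (fun z => eval z (perPoly (Fin 4) K)) hκ hi hii hiii d hd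
    exact ⟨c, β, fun u y hy => hcβ u y (LinearMap.mem_ker.1 hy)⟩
  -- case analysis on `r = dim im bL`
  have hr : finrank K (LinearMap.range bL) = 8 ∨ finrank K (LinearMap.range bL) = 9 ∨
      finrank K (LinearMap.range bL) = 10 ∨ finrank K (LinearMap.range bL) = 11 ∨
      finrank K (LinearMap.range bL) = 12 := by omega
  rcases hr with h8 | h9 | h10 | h11 | h12
  · -- `dim V = 8`, `8` squares: the cell hypothesis `H88`
    exfalso
    obtain ⟨c, β, hcβ⟩ := family 8 (by omega)
    exact H88 V hV3 (by omega) c β hcβ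
  · -- `dim V = 7`, `6` squares: the per-direction reading has rank `≤ 6 < 8` — impossible
    exfalso
    obtain ⟨c, β, hcβ⟩ := family 6 (by omega)
    refine noLowRank_seven₆ V hV3 (by omega) c fun y hy => ⟨fun k => (β k).flip y, fun u => ?_⟩
    obtain ⟨e₀, e₁, he⟩ := hcβ u y hy
    exact ⟨e₀, e₁, fun s => by simpa only [LinearMap.flip_apply] using he s⟩
  · -- `dim V = 6`, `4` squares: the cell hypothesis `H106`
    exfalso
    obtain ⟨c, β, hcβ⟩ := family 4 (by omega)
    exact H106 V hV3 (by omega) c β hcβ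
  · -- `dim V = 5`, `2` squares: the per-direction reading forces `dim V ≤ 4`
    exfalso
    obtain ⟨c, β, hcβ⟩ := family 2 (by omega)
    have h4 := finrank_le_four_of_sum_sq_swap (ι := Fin 2) (by rw [Fintype.card_fin]; norm_num) V
      fun y hy => ⟨c, fun k => (β k).flip y, fun u => by
        obtain ⟨e₀, e₁, he⟩ := hcβ u y hy
        exact ⟨e₀, e₁, fun s => by simpa only [LinearMap.flip_apply] using he s⟩⟩
    omega
  · -- `dim V = 4`, `0` squares: `per_4` is affine along `V`, so all `2 × 2` subpermanents vanish
    -- on `V`, and a `4`-dimensional such space is a row or a column; `2r = 24 = m - 1`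
    obtain ⟨c, β, hcβ⟩ := family 0 (by omega)
    have haff : ∀ (u : Fin 4 × Fin 4 → K), ∀ y ∈ V, ∃ e₀ e₁ : K, ∀ s : K,
        eval (u + s • y) (perPoly (Fin 4) K) = e₀ + s * e₁ := by
      intro u y hy
      obtain ⟨e₀, e₁, he⟩ := hcβ u y hy
      refine ⟨e₀, e₁, fun s => ?_⟩
      have h := he s
      simpa using h
    have hB := perm_two_blocks_of_affine V haff
    have h4 : finrank K V = 4 := by omega
    refine ⟨by omega, i₀, D, bL, CL, κ, hD, hDs, hCs, hκ, hi, hii, hiii, by omega, h4, ?_⟩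
    exact row_or_col_of_perm_two_blocks V hB h4

end Summit.ValiantsHypothesis.ValiantsHypothesis.Theorems.SymPencilSdcPerFourTwentySixReduction

end
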